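import Literature.NumberTheory.LFunctions.Zhang2022.RepairBlenMuNu
import Literature.NumberTheory.LFunctions.Zhang2022.KnifeEdgeDiscWeightScale

/-!
# Zhang (2022) §18-margin repair rung — barrier extension for B-len (L-b)∣ν, the LIPSCHITZ νψ-overhang
# sub-class: the family `familyNuLipOverhangAll`, DECIDED BY THEOREM (p468144 — row E-074′ as a kernel theorem on
# `Ψ₁`), relative discrete-mean currency, NO slot; absolute currency at scale `𝔞` modulo the named
# nodes Prop71 / Lemma81 / Prop22i / Lemma23 only

Trunk T-ANT (NumberTheory/LFunctions). Y. Zhang, *Discrete mean estimates and the Landau–Siegel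
zero*, arXiv:2211.02515v1 (2022) [Zhang2022LandauSiegel] — **an unrefereed manuscript under
adjudication. WHAT THIS IS NOT: nothing here asserts or denies its Theorems 1–2 or any analytic lemma;
no claim about Landau–Siegel zeros, about Parity, or about a repaired `Margin232` is made. The theorem below
is a statement about the manuscript's discrete mean as architected (a finite sum over `Ψ₁ × 𝔷(ψ)` with the
(A)-world hypotheses `Re ρ = ½`, `Re 𝔠*·Re ω ≥ 0` DISPLAYED), not about zeros of `L`-functions.** Cell
`landau-siegel` (rung F-S3), sub-cell E (barrier extension), seat ls-Blen-typer-2 g2, stub S-E-bt2-2 (proposed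
INBOX 21:11:07Z; ls-Blen-plan g2 (author side) 21:15:32Z «a Lipschitz sub-class DECIDED BY THEOREM in the relative
(E-003/familyFarPiece) currency is STRONGER coverage than the conditional slot row ⇒ declare wider/stronger: slot
discharged on lipOverhang, no narrowing of 𝒟_len, no erratum … ROW SPLIT of record for blenWord2's ν constructor(s):
48 ν rows = 36 LIPSCHITZ (len-nu-{bump,front,back}-…) → familyNuLipOverhangAll (DECIDED, unconditional) + 12 JUMP
(len-nu-rampcut-…) → typer-1's conditional familyNuOverhang (E-074′ slot displayed)»; ls-barrier-plan g1 21:21:29Z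
(4) «ν split: Lipschitz sub-class DECIDED BY THEOREM via p468144 E-074′ kernel, remainder CONDITIONAL slot row»).
Extension protocol of `RepairRplus` (p455670) / `barrier/ASSIGNMENTS.md` §0 (BINDING 19:49:26Z: a per-world family
`familyNuLipOverhang c′` AND the closed term `familyNuLipOverhangAll` whose verdict quantifies the world `c′`);
companion of `RepairBlenMuNu` (p469249, S-E-bt2-1, ls-Blen-typer-1 g2: the CONDITIONAL ν row `familyNuOverhangAll`
over `bvOverhang` with the E-074′ slot `NuMeanInvisible c′ θ (bvOverhang θ) S` displayed) — imported here for the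
C2 embedding by term; ls-barrier-plan g1 21:45:27Z books `blenWord3 := blenWord2 ++ [familyNuLipOverhangAll]`.

## The word this row serves (C1) — KILL(B-len) OF RECORD (ls-lead 19:19:33Z, RATIFIED director-frontier g6
## 19:31:07Z; countersignature REF-B1 19:15:24Z over v2.3 23f7f953463b7ce2, covering v2.4), text of record
## B-len/KILL-draft.md v2.4 sha16 b46628540b6b957c

§1 head, VERBATIM: «KILL(B-len) INSIDE 𝒟_len GIVEN B-AH (E-014) [director AMENDMENT 18:15:06Z / ls-lead RULE
18:15:52Z form; template B-multi KILL-CERT v2.2 09119f7aef1550b3]: no design d of the class 𝒟_len of §2 — long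
mollifiers, at least one coefficient piece with top θ ∈ (1, 2) beyond Zhang's wall θ* = 1 — closes Zhang's
criterion at MAIN ORDER in the currency of §5 without an input of E*-len strength». Its (νψ) clause, VERBATIM:
«(νψ = (1∗χ)ψ) NOTHING can make it close: the class is invisible-(A) at main order (E-074′ `NuPieceInvisible`,
derivation S verdict-inert, ls-theory RULING 17:33:45Z: TRUE(u ⊕ v_ν) = TRUE(u) = 𝔅(u) ≥ 0)».

§2 (L-b), VERBATIM (the class text this row covers in part): «(L-b) arithmetic coefficient classes on an OVERHANG
piece [1, θ] (or whole profile [0, θ]) glued to an in-class bulk: Λχψ-type a(n) = χψ(n)·(Λ^{∗k}/log^k P)(n)·v(z_n),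
k ≤ 2 (S1-Λ; rows E-070/E-071); μψ one-sided whole-profile g on [0, b], b ∈ (1,2) (rows E-072/E-073); νψ =
(1∗χ)ψ·v(z_n) and its variants ν·log n, ν∗(smooth), (1∗χ)(P_j/n)^β (S3; row E-074′ — invisible-(A)); [general
bounded a(n), |a(n)| ≤ 1, arbitrary beyond P: STATEMENT ONLY (E-032 top > 1 half) = n-len-1].» Narrowings of the
word, carried VERBATIM and never claimed here: «DECLARED NARROWINGS (REF-B1 17:38:07Z, verbatim): n-len-1
general-bounded = statement only (E-032 top>1 half); n-len-2 L13 composite family = E-076/E-077 ceiling/enabler rows,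
averaged_only, not a lever; n-len-3 knots ≤ 5/4 evaluated, θ ∈ (5/4, 2) of 𝒟_len covered by the price/structure
argument only.» Premise of the word, BY NAME: «GIVEN B-AH (E-014, GLOBAL form)» — **the family theorem below does
not use B-AH; B-AH is the word's premise for reading (A)-world slots, and THIS row has no slot.** The (c)-door of
record: registry row E-085 «non-model main-order entry» (open, none known; not touched here).

## The family (this row) — DELTAS declared against the §2 (L-b) ν text

**CURRENCY OF RECORD (REF-B1 22:14:23Z n1; ls-Blen-plan g2 22:20:19Z (2)).** KILL-draft v2.4 §5 speaks of the
main-order sign of the TRUE main term in `𝔞𝔓` units: the row's statement IN THAT CURRENCY is Part 5 —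
`familyNuLipOverhangAll_mainTerm_add` / `mainTerm_add_nuPiece_lipOverhang_frakA` (a bulk with main constant `m·𝔞𝔓`
keeps `m` after the Lipschitz ν-overhang is glued, modulo the named nodes `Prop71`, `Lemma81`, `Prop22i`, `Lemma23 c′`)
with `nuMeanInvisible_lipOverhang_frakA`; Part 2's relative inequality (`familyNuLipOverhangAll_decided`, rate
`δ = 4K·𝓛^{−180}`, only the two (b)-binders displayed) is the HYPOTHESIS-LIGHT LEMMA from which it follows.
**DECLARED DIFFERENCES (REF-B1 n2), none silent:** WIDER — complex-valued profiles `v`, any Lipschitz constant `K`,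
any bulk `F` (the word: real polynomial profiles glued to an in-class bulk); NARROWER — the 12 jump rows
`len-nu-rampcut-*` and the variants «ν∗(smooth)» and `(P_j/n)^β` at a FIXED `β > 0` are NOT members: they stay in
the CONDITIONAL row `familyNuOverhangAll` (p469249, slot E-074′ displayed) resp. statement-only; the variants
«ν·log n» (normalised) and `(P_j/n)^{b/log P}` ARE members (Part 6). Coverage is counted once per design row:
36 continuous ν rows here (`blenWord3`'s constructor `nuLip`, p470514; class of record `Rplusplus9` row 34, p470741),
12 jump rows there (REF-B1 n3).

* CLASS COVERED: the νψ-overhang `(1∗χ)(n)ψ(n)·v(z_n)` on `[1, θ]`, `1 < θ < 2` (the word's box), with `v`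
  LIPSCHITZ on `ℝ` and `= 0` off `[1, θ]` (⇒ wall value `v(1) = 0`, top value `v(θ) = 0`; kinks allowed), glued to
  ANY bulk test family `F` (wider than «an in-class bulk»: the bulk is universally quantified in the verdict).
  Of the 48 ν rows of DESIGN-MAP-len v0.8 466a1df1b6d1231c: the 36 `len-nu-{bump,front,back}-*` rows (polynomial
  profiles on `[1, top]`, zero at both ends — ls-Blen-plan 21:15:32Z) are members; C4 below types the bump rows.
* NOT COVERED BY THIS ROW (declared, = the remainder of the §2 ν text): (i) JUMP profiles — the 12
  `len-nu-rampcut-*` rows (`v = t` on `[1,θ)`, jump `1 → 0` AT `z = θ`) and any wall value `v(1⁺) ≠ 0`: the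
  mechanism of p468144 needs the partial sum `X₃(y,ψ)` POINTWISE at the jump abscissa `y = P^θ`, which (3.4)–(3.6)
  do not provide — they belong to the CONDITIONAL row `familyNuOverhang` of `RepairBlenMuNu` (S-E-bt2-1, slot E-074′
  displayed); (ii) of the VARIANTS «ν·log n, ν∗(smooth), (1∗χ)(P_j/n)^β» (no design rows): «ν∗(smooth)» and the twist
  at a FIXED exponent β are statement only — «ν·log n» (normalised) and the twist at scale `b/log P` ARE covered as
  profile changes (Part 6); (iii) n-len-1 (general bounded) — statement only, as in the word.
* CURRENCY (C3(e)): the RELATIVE discrete-mean currency of E-003 / `familyFarPiece` / `familyFarBV` — sums over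
  `Skeleton.idx χ` with weights `Re 𝔠*·Re ω`, bounds against `discMean + discWeight`; the two conditional inputs are
  the DISPLAYED (A)-world hypotheses of kind (b): `Re ρ = ½` on the sampled zeros (Prop. 2.2 (i)'s output) and
  `Re 𝔠*·Re ω ≥ 0` (Lemma 2.3's output) — `familyNuLipOverhangAll_verdict_of_prop22i` shows they are exactly the nodes
  `Prop22i` / `Lemma23 c′`. NO world slot, NO dictionary, NO scale: the row is DECIDED BY THEOREM
  (`KnifeEdge.abs_discMean_add_nuPoly_sub_le`, p468144 ← `norm_nuPoly_le_of_psiOne`: Zhang's (4.8) Abel device on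
  `Ψ₁` AS DEFINED by (3.4)–(3.6), unconditional). The absolute-currency reading (`NuMeanInvisible` at a scale `S`)
  needs in addition the weight-mass binder of p468144 `nuMeanInvisible_lipOverhang_of_weightMass` — not used here.

* Design `d : NuLipDesign` = `(θ, K, v)`; `InClass d` = `1 < θ < 2 ∧ LipschitzWith K v ∧ (v = 0 off [1,θ])`
  (NO analytic hypothesis); `Verdict d` = for EVERY `c′`, all large `D`, every real primitive `χ`: displayed
  binders → for EVERY bulk `F`, `¬ (δ·(Ξ(F) + discWeight) + δ²·discWeight < |Ξ(F + A_ν) − Ξ(F)|)`, `δ = 4K·𝓛^{−180}`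
  — «no main-order gain or loss from the ν-overhang, whatever it is glued to» (= the word's «TRUE(u ⊕ v_ν) =
  TRUE(u)» for the sub-class, now a theorem rather than an S-derivation).
* **`familyNuLipOverhang_decided c′`** (per world) / **`familyNuLipOverhangAll_decided`** (closed term; `familyNuLipOverhangAll_iff`);
  unbundled `not_mainOrderGain_nuLipOverhang`; `rplus_nuLipOverhang_decided c′` / `rplus_nuLipOverhangAll_decided :
  ClassDecided (Rplus ++ [familyNuLipOverhangAll])`; the piece alone `discMean_nuLipOverhang_le` (`Ξ(A_ν) ≤ δ²·discWeight`,
  only `Re ρ = ½` displayed).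
* **ABSOLUTE currency at the χψ scale `𝔞`, modulo NAMED NODES ONLY (Part 5).** The weight-mass binder of p468144 is
  DISCHARGED from the manuscript's own nodes: `discWeight_le_frakAScale` (`Prop71 → Lemma81 → Prop22i → Lemma23 →
  ∃ W, discWeight ≤ W·𝓛⁹·𝔞𝔓` eventually under (A); from the units lemma `Skeleton.discWeight_trivialScale_window`,
  KnifeEdgeDiscWeightScale, `discWeight ≤ 3𝓛⁹𝔓`, and `frakALowerBound_holds`, `𝔞 ≥ a₀`), hence
  **`nuMeanInvisible_lipOverhang_frakA : Prop71 c′ → Lemma81 c′ → Prop22i → Lemma23 c′ →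
  NuMeanInvisible c′ θ (lipOverhang θ) 𝔞`** (`1 < θ ≤ 2`), `not_nuCloses_lipOverhang_frakA` (dictionary of record
  `(M, X) = (0, 0)`, no closing — p461177 `not_nuCloses_of_invisible`) and `mainTerm_add_nuPiece_lipOverhang_frakA` /
  `familyNuLipOverhangAll_mainTerm_add` (a bulk with main constant `m·𝔞𝔓`, the `Eval823` shape, keeps `m` — p461177
  `mainTerm_add_nuPiece`): ls-theory's ruling «TRUE(u ⊕ v_ν) = TRUE(u)» for the Lipschitz class as a kernel
  implication from the SAME four nodes every in-class verdict of the tree rests on.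

## C2 / C3(c′) / C4

* C2 BY TERM: every member's profile is in `KnifeEdge.lipOverhang θ` (`NuLipDesign.InClass.lipOverhang`) and hence in
  the ruling's class `KnifeEdge.bvOverhang θ` (`NuLipDesign.InClass.bvOverhang`, via p468144 `bvOverhang_of_lipOverhang`);
  `NuLipDesign.toNuDesign : (θ, K, v) ↦ (θ, v, 0)` maps members into p469249's `Repair.NuDesign` class
  (`NuLipDesign.InClass.toNuDesign`, = `NuDesign.inClass_of_lipOverhang`), and **`familyNuOverhang_conclusion_of_nuLip`**
  proves, for the image, the CONCLUSION of the conditional row's verdict at scale `𝔞` (`NuDict … 0 0` on the Lipschitz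
  class ∧ `HasMainConstant c′ 𝔞 F m → HasMainConstant c′ 𝔞 (d.toNuDesign.extend F) m`) from `Prop71`, `Lemma81`,
  `Prop22i`, `Lemma23 c′` WITHOUT the slot: this family is the sub-class of the conditional row's class on which the
  E-074′ slot is DISCHARGED (count coverage once per design row: 36 here, 12 there — ls-Blen-plan 21:15:32Z (2)).
  Amplitude zero (`v = 0`) is a member (`inClass_zero`) with the tautological verdict (`verdict_zero`).
* C3(c′): no world slot to inhabit; the displayed binders are node outputs (kind (b)), load-bearing in the proof
  (off the line `|n^{s₀−ρ}|` is not `1`; without `𝔠*ω ≥ 0` the cross term has no Cauchy–Schwarz) — reported, nothing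
  hidden. C5: std axioms; no numerics (C7 not engaged).
* C4 (members BY TERM, data from the design rows; no kit number): `nuLipBump θ` = the ν-overhang of
  `len-nu-bump-u{52,32}-th{θ}` — profile `Repair.polyProf θ (Repair.bumpPoly θ)` (p467353; `4t(1−t)`,
  `t = (z−1)/(θ−1)`), Lipschitz constant `4/(θ−1)` PROVED (`lipschitzWith_bumpProf`; `= 80` at `θ = 21/20`, `16` at
  `5/4`); instances `inClass_nuLipBump_2120` (coefficients `[−1680, 3280, −1600]`, `bumpPoly_eval_2120`) and
  `inClass_nuLipBump_54` (`[−80, 144, −64]`, `Repair.bumpPoly_eval_five_fourths`), verdicts `verdict_nuLipBump`; and the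
  tent `nuLipTent θ` (`KnifeEdge.lipTent`, `1`-Lipschitz: `lipschitzWith_lipTent`). Part 4b: the front/back rows
  `nuLipFront θ` / `nuLipBack θ` (`frontPoly`/`backPoly` = `(27/4)t(1−t)²` / `(27/4)t²(1−t)`, coefficient identities at
  `5/4`, SHARP Lipschitz constant `27/(4(θ−1))` by the mean value inequality `abs_eval_sub_le_of_derivative`), and
  **`nuLip_members_batch1`**: for every top of record `θ ∈ {81/80, 41/40, 21/20, 17/16, 11/10, 5/4}` the bump, front and
  back overhangs are members — all 36 Lipschitz ν rows of BATCH-1 by term (18 overhangs × 2 bulks).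

## Part 6 — the word's ν VARIANTS (ls-Blen-plan g2 21:15:32Z (4)): two of three are PROFILE CHANGES inside the class

`lipschitzWith_mul_of_overhang` / `NuLipDesign.InClass.twist`: a multiplier `g` bounded and Lipschitz on `[1,θ]` keeps
membership (`(θ, K, v) ↦ (θ, GK + LK(θ−1), g∘clamp·v)`). (a) «ν·log n» in Zhang's normalisation `ν(n)(log n/log P)`:
`nuLogPoly`, `nuLogPoly_eq_nuPoly` (= `nuPoly` of `z ↦ clamp(z)·v(z)`), member `NuLipDesign.logTwist` /
`InClass.logTwist`, verdict ON `nuLogPoly` `not_mainOrderGain_nuLog` — COVERED; (c) «(1∗χ)(P_j/n)^β» at the method's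
scale `β = b/log P` (= multiplier `e^{b(z_j − z)}`): `expTwist_bounds`, member `NuLipDesign.expTwist` / `InClass.expTwist`
— COVERED; a FIXED exponent `β > 0` (gain `P^{(θ−1)β}`) is NOT covered; (b) «ν∗(smooth)» is not of the form
`(1∗χ)(n)·w(z_n)` (its partial sums are not `X₃`) — NOT covered (statement only, as declared above).

## References

* Y. Zhang, arXiv:2211.02515v1 (2022), §2 (2.14)–(2.17), Lemma 2.3, Prop. 2.2 (i) [p. 4–6]; §3 (3.5), p. 7
  (`Ψ₁`, `X₃`); §4 Lemma 4.2 (proof) p. 8–9, (4.8) p. 20; §7 (7.2) p. 44.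
  [cite: Zhang2022LandauSiegel, §2 (2.16); §3 (3.5); §4 (4.8); §7 (7.2)]
* Tree: `KnifeEdgeNuInvisiblePsiOne` (p468144: `abs_discMean_add_nuPoly_sub_le`, `_of_prop22i`, `discMean_nuPoly_le`,
  `nuMeanInvisible_lipOverhang_of_weightMass`, `lipOverhang`, `lipTent`, `bvOverhang_of_lipOverhang`), `KnifeEdgeNuOverhang`
  (p461177: `nuPoly`, `bvOverhang`, `NuMeanInvisible`, `not_nuCloses_of_invisible`, `mainTerm_add_nuPiece`),
  `KnifeEdgeDiscWeightScale` (`Skeleton.discWeight_trivialScale_window`, `KnifeEdge.discWeight_eq_repair`),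
  `SkeletonMeanValue` (`Prop71`, `Lemma81`), `SkeletonAssembly` (`frakALowerBound_holds`), `RepairRplus` (p455670:
  `DesignFamily`, `Rplus`, `rplus_extend`), `RepairBlenLambda` (p467353: `polyProf`, `bumpPoly`).
«The programme SEARCHES and TYPES; no claim about Landau–Siegel zeros, Theorems 1–2 of arXiv:2211.02515 or a
repaired Margin232 until a kernel theorem says so.»
-/

noncomputable section

open Real Complex Set
open scoped NNReal ENNReal

namespace Literature.NumberTheory.LFunctions.Zhang2022

namespace Repair

open KnifeEdge Skeleton

/-! ### Part 1 — Lipschitz polynomial profiles on `[1, θ]` (the C4 members' shape): `polyProf θ p` is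
`K`-Lipschitz on `ℝ` as soon as `p(1) = p(θ) = 0` and `p` is `K`-Lipschitz on `[1, θ]` -/

/-- The projection of `ℝ` onto `[1, θ]`. [cite: Zhang2022LandauSiegel, §7 (7.2) p.44] -/
def clampI (θ z : ℝ) : ℝ := max 1 (min z θ)

/-- The projection is `1`-Lipschitz. [cite: Zhang2022LandauSiegel, §7 (7.2) p.44] -/
theorem abs_clampI_sub_le (θ x y : ℝ) : |clampI θ x - clampI θ y| ≤ |x - y| := by
  unfold clampI
  calc |max 1 (min x θ) - max 1 (min y θ)| ≤ max |(1 : ℝ) - 1| |min x θ - min y θ| :=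
        abs_max_sub_max_le_max _ _ _ _
    _ ≤ max |(1 : ℝ) - 1| (max |x - y| |θ - θ|) := max_le_max le_rfl (abs_min_sub_min_le_max _ _ _ _)
    _ = |x - y| := by simp [abs_nonneg]

/-- The projection lands in `[1, θ]` (`θ ≥ 1`). [cite: Zhang2022LandauSiegel, §7 (7.2) p.44] -/
theorem clampI_mem {θ : ℝ} (hθ : 1 ≤ θ) (z : ℝ) : clampI θ z ∈ Icc 1 θ :=
  ⟨le_max_left _ _, max_le hθ (min_le_right _ _)⟩

/-- On `[1, θ]` the projection is the identity. [cite: Zhang2022LandauSiegel, §7 (7.2) p.44] -/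
theorem clampI_eq_self {θ z : ℝ} (hz : z ∈ Icc 1 θ) : clampI θ z = z := by
  unfold clampI
  rw [min_eq_left hz.2, max_eq_right hz.1]

/-- A polynomial profile vanishing at both ends of `[1, θ]` is the polynomial of the projection.
[cite: Zhang2022LandauSiegel, §7 (7.2) p.44] -/
theorem polyProf_eq_eval_clampI {θ : ℝ} (hθ : 1 ≤ θ) {p : Polynomial ℝ} (h1 : p.eval 1 = 0)
    (h2 : p.eval θ = 0) (z : ℝ) : polyProf θ p z = ((p.eval (clampI θ z) : ℝ) : ℂ) := by
  unfold polyProf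
  by_cases hz : 1 ≤ z ∧ z ≤ θ
  · rw [if_pos hz, clampI_eq_self ⟨hz.1, hz.2⟩]
  · rw [if_neg hz]
    rcases not_and_or.mp hz with h | h
    · have : clampI θ z = 1 := by
        unfold clampI
        rw [max_eq_left]
        exact (min_le_left _ _).trans (not_le.mp h).le
      rw [this, h1]; simp
    · have : clampI θ z = θ := by
        unfold clampI
        rw [min_eq_right (not_le.mp h).le, max_eq_right hθ]
      rw [this, h2]; simp

/-- A polynomial profile vanishes off `[1, θ]`. [cite: Zhang2022LandauSiegel, §7 (7.2) p.44] -/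
theorem polyProf_support (θ : ℝ) (p : Polynomial ℝ) (z : ℝ) (hz : z < 1 ∨ θ < z) : polyProf θ p z = 0 := by
  unfold polyProf
  rw [if_neg]
  rintro ⟨h1, h2⟩
  rcases hz with hz | hz <;> linarith

/-- **Lipschitz transfer:** if `p(1) = p(θ) = 0` and `|p(x) − p(y)| ≤ K|x − y|` on `[1, θ]`, the profile
`polyProf θ p` is `K`-Lipschitz on `ℝ`. [cite: Zhang2022LandauSiegel, §7 (7.2) p.44] -/
theorem lipschitzWith_polyProf {θ : ℝ} (hθ : 1 ≤ θ) {p : Polynomial ℝ} (h1 : p.eval 1 = 0)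
    (h2 : p.eval θ = 0) {K : ℝ≥0}
    (hK : ∀ x ∈ Icc 1 θ, ∀ y ∈ Icc 1 θ, |p.eval x - p.eval y| ≤ K * |x - y|) :
    LipschitzWith K (polyProf θ p) := by
  refine LipschitzWith.of_dist_le_mul fun x y => ?_
  rw [polyProf_eq_eval_clampI hθ h1 h2, polyProf_eq_eval_clampI hθ h1 h2, Complex.dist_eq,
    ← Complex.ofReal_sub, Complex.norm_real, Real.norm_eq_abs, Real.dist_eq]
  exact (hK _ (clampI_mem hθ x) _ (clampI_mem hθ y)).trans
    (mul_le_mul_of_nonneg_left (abs_clampI_sub_le θ x y) K.2)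

/-- **The bump of record is `4/(θ−1)`-Lipschitz on `[1, θ]`** (`|p(x) − p(y)| = 4(θ−1)^{−2}|x − y|·|θ + 1 − x − y|`
and `|θ + 1 − x − y| ≤ θ − 1` there). [cite: Zhang2022LandauSiegel, §7 (7.2) p.44] -/
theorem abs_bumpPoly_sub_le {θ : ℝ} (hθ : 1 < θ) {x y : ℝ} (hx : x ∈ Icc 1 θ) (hy : y ∈ Icc 1 θ) :
    |(bumpPoly θ).eval x - (bumpPoly θ).eval y| ≤ 4 / (θ - 1) * |x - y| := by
  have hθ0 : 0 < θ - 1 := sub_pos.2 hθ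
  rw [bumpPoly_eval, bumpPoly_eval]
  have hfac : 4 / (θ - 1) ^ 2 * (x - 1) * (θ - x) - 4 / (θ - 1) ^ 2 * (y - 1) * (θ - y)
      = 4 / (θ - 1) ^ 2 * ((x - y) * (θ + 1 - x - y)) := by ring
  rw [hfac, abs_mul, abs_mul, abs_of_pos (by positivity : (0 : ℝ) < 4 / (θ - 1) ^ 2)]
  have hb : |θ + 1 - x - y| ≤ θ - 1 := abs_le.2 ⟨by linarith [hx.2, hy.2], by linarith [hx.1, hy.1]⟩
  calc 4 / (θ - 1) ^ 2 * (|x - y| * |θ + 1 - x - y|) ≤ 4 / (θ - 1) ^ 2 * (|x - y| * (θ - 1)) :=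
        mul_le_mul_of_nonneg_left (mul_le_mul_of_nonneg_left hb (abs_nonneg _)) (by positivity)
    _ = 4 / (θ - 1) * |x - y| := by field_simp

/-- **The bump profile `polyProf θ (bumpPoly θ)` is `4/(θ−1)`-Lipschitz on `ℝ`** (`θ > 1`).
[cite: Zhang2022LandauSiegel, §7 (7.2) p.44] -/
theorem lipschitzWith_bumpProf {θ : ℝ} (hθ : 1 < θ) :
    LipschitzWith (Real.toNNReal (4 / (θ - 1))) (polyProf θ (bumpPoly θ)) := by
  refine lipschitzWith_polyProf hθ.le (by rw [bumpPoly_eval]; ring) (by rw [bumpPoly_eval]; ring) ?_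
  intro x hx y hy
  rw [Real.coe_toNNReal _ (div_nonneg (by norm_num) (sub_nonneg.2 hθ.le))]
  exact abs_bumpPoly_sub_le hθ hx hy

/-! ### Part 2 — the family `familyNuLipOverhangAll` (B-len (L-b)∣ν, LIPSCHITZ sub-class): DECIDED BY THEOREM
(`KnifeEdge.abs_discMean_add_nuPoly_sub_le`, p468144) in the relative discrete-mean currency — no world slot;
the (A)-world hypotheses `Re ρ = ½` and `Re 𝔠*·Re ω ≥ 0` on the index set DISPLAYED (kind (b)) -/

/-- A Lipschitz νψ-overhang design: top `θ`, Lipschitz constant `K`, profile `v` on the logarithmic scale (used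
as the coefficient `(1∗χ)(n)ψ(n)·v(log n/log P)·n^{−ρ}` on `P ≤ n < P^θ`, glued to ANY bulk test family `F`,
which is quantified in the verdict). [cite: Zhang2022LandauSiegel, §2 (2.16); §7 (7.2) p.44] -/
structure NuLipDesign where
  /-- top exponent: the overhang is `[1, θ]`, i.e. `P ≤ n ≤ P^θ` -/
  θ : ℝ
  /-- Lipschitz constant of the profile -/
  K : ℝ≥0
  /-- the overhang profile on the logarithmic scale -/
  v : ℝ → ℂ

/-- Membership (NO analytic hypothesis): the word's box `1 < θ < 2`, `v` is `K`-Lipschitz on `ℝ` and vanishes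
off `[1, θ]` (hence wall value `v(1) = 0` and top value `v(θ) = 0` — `KnifeEdge.LipOverhang.apply_of_le_one` /
`apply_of_le`). [cite: Zhang2022LandauSiegel, §7 (7.2) p.44] -/
def NuLipDesign.InClass (d : NuLipDesign) : Prop :=
  1 < d.θ ∧ d.θ < 2 ∧ LipschitzWith d.K d.v ∧ ∀ z, z < 1 ∨ d.θ < z → d.v z = 0

/-- The displayed rate `δ(D) = 4K·𝓛^{−180}` of the verdict. [cite: Zhang2022LandauSiegel, §4 (4.8) p. 20] -/
def NuLipDesign.rate (d : NuLipDesign) (D : ℕ) : ℝ := 4 * d.K * (ell D ^ 180)⁻¹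

/-- **The verdict in the world `c′`: «no main-order gain or loss from the ν-overhang, glued to ANY design»** (relative
discrete-mean currency of E-003 / `familyFarPiece`; (A)-world hypotheses DISPLAYED, kind (b): `Re ρ = ½` on the sampled zeros =
Prop. 2.2 (i)'s output, `Re 𝔠*·Re ω ≥ 0` = Lemma 2.3's output): for EVERY shift parameter `c′`, for all large `D`
and every real primitive `χ (mod D)`, IF the two displayed hypotheses hold on `Skeleton.idx χ`, then for EVERY family
of test values `F` (the bulk the overhang is glued to — any design of any class),
`¬ (δ·(Ξ(F) + discWeight) + δ²·discWeight < |Ξ(F + A_ν) − Ξ(F)|)`, `δ = 4K·𝓛^{−180}`, `Ξ = KnifeEdge.discMean c′ χ`,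
`A_ν(ψ, s) = KnifeEdge.nuPoly χ (p,ψ) v ⌈P^θ⌉ s`. [cite: Zhang2022LandauSiegel, §2 (2.16)–(2.17), Lemma 2.3, Prop. 2.2 (i), §3 (3.5), §4 (4.8)] -/
def NuLipDesign.VerdictAt (d : NuLipDesign) (c' : ℝ) : Prop :=
  ForAllLarge fun D _ χ =>
    (∀ i ∈ idx χ, (i.2).re = 1 / 2) →
      (∀ i ∈ idx χ, 0 ≤ (cstar c' D i.1 i.2).re * (omegaW D i.2).re) →
        ∀ F : Skeleton.Chr D → ℂ → ℂ,
          ¬ (d.rate D * (KnifeEdge.discMean c' χ F + KnifeEdge.discWeight c' χ)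
                + d.rate D ^ 2 * KnifeEdge.discWeight c' χ <
              |KnifeEdge.discMean c' χ (fun x s => F x s + nuPoly χ x d.v ⌈bigP D ^ d.θ⌉₊ s)
                - KnifeEdge.discMean c' χ F|)

/-- The verdict over ALL shift parameters `c′` (the closed term's verdict). [cite: Zhang2022LandauSiegel, §2 (2.16); §4 (4.8)] -/
def NuLipDesign.Verdict (d : NuLipDesign) : Prop := ∀ c' : ℝ, d.VerdictAt c'

/-- **family «B-len (L-b)∣ν, Lipschitz νψ-overhang, in the world `c′`»** (per-detector-shift family; the closed
term is `familyNuLipOverhangAll`). [cite: Zhang2022LandauSiegel, §2 (2.16); §3 (3.5); §4 (4.8); §7 (7.2)] -/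
def familyNuLipOverhang (c' : ℝ) : DesignFamily where
  Design := NuLipDesign
  InClass := NuLipDesign.InClass
  Verdict d := d.VerdictAt c'

/-- The per-`c′` family is decided (p468144). [cite: Zhang2022LandauSiegel, §2 (2.16); §3 (3.5); §4 (4.8)] -/
theorem familyNuLipOverhang_decided (c' : ℝ) : (familyNuLipOverhang c').Decided := fun d h =>
  (abs_discMean_add_nuPoly_sub_le c').mono fun _ _ _ _ _ hh hline hw F =>
    not_lt.2 (hh hline hw d.θ h.1 h.2.1.le d.v d.K h.2.2.1 h.2.2.2 F)

/-- `R⁺ ++ [Lipschitz ν-overhang in the world c′]` is decided. [cite: Zhang2022LandauSiegel, §2 (2.32)–(2.33)] -/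
theorem rplus_nuLipOverhang_decided (c' : ℝ) : ClassDecided (Rplus ++ [familyNuLipOverhang c']) :=
  rplus_extend (familyNuLipOverhang_decided c')

/-- **family «B-len (L-b)∣ν, Lipschitz νψ-overhang on `[1,θ]`, `1 < θ < 2`, glued to any bulk — relative
discrete-mean currency, NO slot»** (the sub-class of the ruling's class `bvOverhang θ` on which row E-074′ is a
kernel theorem, p468144). [cite: Zhang2022LandauSiegel, §2 (2.16); §3 (3.5); §4 (4.8); §7 (7.2)] -/
def familyNuLipOverhangAll : DesignFamily where
  Design := NuLipDesign
  InClass := NuLipDesign.InClass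
  Verdict := NuLipDesign.Verdict

/-- **B-len (L-b)∣ν — the Lipschitz sub-class is DECIDED, BY THEOREM** (`KnifeEdge.abs_discMean_add_nuPoly_sub_le`,
p468144: Zhang's own (4.8) partial-summation device on `Ψ₁` AS DEFINED by (3.4)–(3.6) — no Assumption (A), no
exceptional set, no E-074′ slot): gluing a Lipschitz νψ-overhang to any design moves its discrete mean by at most
`δ·(Ξ(F) + discWeight) + δ²·discWeight`, `δ = 4K𝓛^{−180}`. [cite: Zhang2022LandauSiegel, §2 (2.16); §3 (3.5); §4 (4.8)] -/
theorem familyNuLipOverhangAll_decided : familyNuLipOverhangAll.Decided := fun d h c' =>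
  familyNuLipOverhang_decided c' d h

/-- Same class; the closed verdict is the conjunction over all worlds `c′`. [cite: Zhang2022LandauSiegel, §2 (2.16)] -/
theorem familyNuLipOverhangAll_iff (d : NuLipDesign) :
    (familyNuLipOverhangAll.InClass d ↔ ∀ c' : ℝ, (familyNuLipOverhang c').InClass d) ∧
      (familyNuLipOverhangAll.Verdict d ↔ ∀ c' : ℝ, (familyNuLipOverhang c').Verdict d) :=
  ⟨⟨fun h _ => h, fun h => h 0⟩, Iff.rfl⟩

/-- Unbundled form (every hypothesis a binder). [cite: Zhang2022LandauSiegel, §2 (2.16); §3 (3.5); §4 (4.8)] -/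
theorem not_mainOrderGain_nuLipOverhang {θ : ℝ} (hθ1 : 1 < θ) (hθ2 : θ < 2) {K : ℝ≥0} {v : ℝ → ℂ}
    (hv : LipschitzWith K v) (hsupp : ∀ z, z < 1 ∨ θ < z → v z = 0) (c' : ℝ) :
    ForAllLarge fun D _ χ =>
      (∀ i ∈ idx χ, (i.2).re = 1 / 2) →
        (∀ i ∈ idx χ, 0 ≤ (cstar c' D i.1 i.2).re * (omegaW D i.2).re) →
          ∀ F : Skeleton.Chr D → ℂ → ℂ,
            ¬ (4 * K * (ell D ^ 180)⁻¹ * (KnifeEdge.discMean c' χ F + KnifeEdge.discWeight c' χ)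
                  + (4 * K * (ell D ^ 180)⁻¹) ^ 2 * KnifeEdge.discWeight c' χ <
                |KnifeEdge.discMean c' χ (fun x s => F x s + nuPoly χ x v ⌈bigP D ^ θ⌉₊ s)
                  - KnifeEdge.discMean c' χ F|) :=
  familyNuLipOverhangAll_decided ⟨θ, K, v⟩ ⟨hθ1, hθ2, hv, hsupp⟩ c'

/-- **`R⁺ ++ [Lipschitz ν-overhang]` is decided.** [cite: Zhang2022LandauSiegel, §2 (2.32)–(2.33); §7 (7.2)] -/
theorem rplus_nuLipOverhangAll_decided : ClassDecided (Rplus ++ [familyNuLipOverhangAll]) :=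
  rplus_extend familyNuLipOverhangAll_decided

/-- **The displayed binders are exactly the two skeleton nodes of every positivity endgame:** given `Prop22i` and
`Lemma23 c′`, the verdict holds WITHOUT displayed hypotheses (they are discharged inside, `D ≥ 3`).
[cite: Zhang2022LandauSiegel, §2 Prop. 2.2 (i), Lemma 2.3, (2.16); §4 (4.8)] -/
theorem familyNuLipOverhangAll_verdict_of_prop22i {d : NuLipDesign} (h : d.InClass) {c' : ℝ} (h22 : Prop22i)
    (h23 : Lemma23 c') :
    ForAllLarge fun D _ χ => ∀ F : Skeleton.Chr D → ℂ → ℂ,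
      ¬ (d.rate D * (KnifeEdge.discMean c' χ F + KnifeEdge.discWeight c' χ)
            + d.rate D ^ 2 * KnifeEdge.discWeight c' χ <
          |KnifeEdge.discMean c' χ (fun x s => F x s + nuPoly χ x d.v ⌈bigP D ^ d.θ⌉₊ s)
            - KnifeEdge.discMean c' χ F|) :=
  (abs_discMean_add_nuPoly_sub_le_of_prop22i c' h22 h23).mono fun _ _ _ _ _ hh F =>
    not_lt.2 (hh d.θ h.1 h.2.1.le d.v d.K h.2.2.1 h.2.2.2 F)

/-- **The piece alone** (relative currency, only `Re ρ = ½` displayed): the discrete mean of the ν-overhang of a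
member is at most `δ²·discWeight` (`KnifeEdge.discMean_nuPoly_le`, p468144) — in the (A)-world dictionary language
the class's diagonal AND off-diagonal main terms are zero (`nuDict_zero_of_meanInvisible` shape, p461177).
[cite: Zhang2022LandauSiegel, §2 (2.16); §3 (3.5); §4 (4.8)] -/
theorem discMean_nuLipOverhang_le {d : NuLipDesign} (h : d.InClass) (c' : ℝ) :
    ForAllLarge fun D _ χ => (∀ i ∈ idx χ, (i.2).re = 1 / 2) →
      KnifeEdge.discMean c' χ (fun x s => nuPoly χ x d.v ⌈bigP D ^ d.θ⌉₊ s) ≤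
        d.rate D ^ 2 * KnifeEdge.discWeight c' χ :=
  (discMean_nuPoly_le c').mono fun _ _ _ _ _ hh hline => hh hline d.θ h.1 h.2.1.le d.v d.K h.2.2.1 h.2.2.2

/-! ### Part 3 — C2: the family sits inside the ruling's class (`bvOverhang`, p461177) and inside `lipOverhang`
(p468144); amplitude zero recovers the bulk -/

/-- Every member's profile is in the Lipschitz class `KnifeEdge.lipOverhang θ` of p468144.
[cite: Zhang2022LandauSiegel, §7 (7.2) p.44] -/
theorem NuLipDesign.InClass.lipOverhang {d : NuLipDesign} (h : d.InClass) : KnifeEdge.lipOverhang d.θ d.v 0 :=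
  ⟨⟨d.K, h.2.2.1⟩, h.2.2.2⟩

/-- … hence in the ruling's bounded-variation class `KnifeEdge.bvOverhang θ` (sup and variation `≤ K(θ−1)`):
the Lipschitz family is a SUB-CLASS of the class row E-074′ / the conditional family `familyNuOverhang` (S-E-bt2-1)
speaks about — the sub-class on which the slot is discharged. [cite: Zhang2022LandauSiegel, §7 (7.2) p.44] -/
theorem NuLipDesign.InClass.bvOverhang {d : NuLipDesign} (h : d.InClass) : KnifeEdge.bvOverhang d.θ d.v 0 :=
  bvOverhang_of_lipOverhang h.1.le h.lipOverhang

/-- **C2 BY TERM into the conditional row's design type** (`Repair.NuDesign` of `RepairBlenMuNu`, p469249):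
`(θ, K, v) ↦ (θ, v, 0)`. [cite: Zhang2022LandauSiegel, §7 (7.2) p.44] -/
def NuLipDesign.toNuDesign (d : NuLipDesign) : NuDesign := ⟨d.θ, d.v, fun _ => 0⟩

/-- The embedding maps members to members of `familyNuOverhangAll` / `familyNuOverhang c′ S` (p469249).
[cite: Zhang2022LandauSiegel, §7 (7.2) p.44] -/
theorem NuLipDesign.InClass.toNuDesign {d : NuLipDesign} (h : d.InClass) : d.toNuDesign.InClass :=
  NuDesign.inClass_of_lipOverhang h.1 h.lipOverhang

/-- The zero overhang (amplitude `0`) is a member at every `1 < θ < 2` … [cite: Zhang2022LandauSiegel, §7 (7.2) p.44] -/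
theorem inClass_zero {θ : ℝ} (hθ1 : 1 < θ) (hθ2 : θ < 2) : (⟨θ, 0, fun _ => 0⟩ : NuLipDesign).InClass :=
  ⟨hθ1, hθ2, LipschitzWith.const (0 : ℂ), fun _ _ => rfl⟩

/-- … and for it the verdict is the tautology `Ξ(F + 0) = Ξ(F)` (the bulk alone is untouched: the row adds
nothing to, and takes nothing from, the bulk's own row of the class of record). [cite: Zhang2022LandauSiegel, §2 (2.16)] -/
theorem verdict_zero {θ : ℝ} (hθ1 : 1 < θ) (hθ2 : θ < 2) : (⟨θ, 0, fun _ => 0⟩ : NuLipDesign).Verdict :=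
  familyNuLipOverhangAll_decided _ (inClass_zero hθ1 hθ2)

/-! ### Part 4 — C4: members of record BY TERM — the `len-nu-bump-*` rows of B-len BATCH-1 (DESIGN-MAP-len v0.8)
and the tent -/

/-- **Member of record `len-nu-bump-u{52,32}-th{θ}` (its ν-overhang):** the bump `4t(1−t)`, `t = (z−1)/(θ−1)`, on
`[1, θ]` (`Repair.polyProf θ (Repair.bumpPoly θ)`, p467353 — the same term as the Λ-row member `lenLamBump`),
Lipschitz constant `4/(θ−1)` (`= 80` at `θ = 21/20`, `16` at `θ = 5/4`; ls-Blen-plan 21:15:32Z). The bulk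
`ϰ(1, k)` of the design row is any `F` of the verdict. [cite: Zhang2022LandauSiegel, §7 (7.2) p.44] -/
def nuLipBump (θ : ℝ) : NuLipDesign := ⟨θ, Real.toNNReal (4 / (θ - 1)), polyProf θ (bumpPoly θ)⟩

/-- The bump rows are members at every `1 < θ < 2`. [cite: Zhang2022LandauSiegel, §7 (7.2) p.44] -/
theorem inClass_nuLipBump {θ : ℝ} (hθ1 : 1 < θ) (hθ2 : θ < 2) : (nuLipBump θ).InClass :=
  ⟨hθ1, hθ2, lipschitzWith_bumpProf hθ1, fun z hz => polyProf_support θ _ z hz⟩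

/-- `len-nu-bump-u52-th21:20` / `len-nu-bump-u32-th21:20` (top `21/20`, coefficients `[−1680, 3280, −1600]`).
[cite: Zhang2022LandauSiegel, §7 (7.2) p.44] -/
theorem inClass_nuLipBump_2120 : (nuLipBump (21 / 20)).InClass := inClass_nuLipBump (by norm_num) (by norm_num)

/-- `len-nu-bump-u52-th5:4` / `len-nu-bump-u32-th5:4` (top `5/4`, coefficients `[−80, 144, −64]`,
`Repair.bumpPoly_eval_five_fourths`). [cite: Zhang2022LandauSiegel, §7 (7.2) p.44] -/
theorem inClass_nuLipBump_54 : (nuLipBump (5 / 4)).InClass := inClass_nuLipBump (by norm_num) (by norm_num)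

/-- at `θ = 21/20` the bump is `−1680 + 3280z − 1600z²` (the design file's coefficient list).
[cite: Zhang2022LandauSiegel, §7 (7.2) p.44] -/
theorem bumpPoly_eval_2120 (z : ℝ) : (bumpPoly (21 / 20)).eval z = -1680 + 3280 * z - 1600 * z ^ 2 := by
  rw [bumpPoly_eval]; ring

/-- The verdict for the bump members (instances of `familyNuLipOverhangAll_decided`).
[cite: Zhang2022LandauSiegel, §2 (2.16); §4 (4.8)] -/
theorem verdict_nuLipBump {θ : ℝ} (hθ1 : 1 < θ) (hθ2 : θ < 2) : (nuLipBump θ).Verdict :=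
  familyNuLipOverhangAll_decided _ (inClass_nuLipBump hθ1 hθ2)

/-- **The tent member** `z ↦ min(z − 1, θ − z)⁺` (`KnifeEdge.lipTent`, p468144; `1`-Lipschitz, kink at the
midpoint — kinks are in the class, jumps are not). [cite: Zhang2022LandauSiegel, §7 (7.2) p.44] -/
def nuLipTent (θ : ℝ) : NuLipDesign := ⟨θ, 1, lipTent θ⟩

/-- The tent is `1`-Lipschitz (the class proof `KnifeEdge.lipOverhang_lipTent` records only SOME constant).
[cite: Zhang2022LandauSiegel, §7 (7.2) p.44] -/
theorem lipschitzWith_lipTent (θ : ℝ) : LipschitzWith 1 (lipTent θ) := by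
  refine LipschitzWith.of_dist_le_mul fun x y => ?_
  rw [lipTent, lipTent, NNReal.coe_one, one_mul, Complex.dist_eq, ← Complex.ofReal_sub,
    Complex.norm_real, Real.norm_eq_abs, Real.dist_eq]
  calc |max (min (x - 1) (θ - x)) 0 - max (min (y - 1) (θ - y)) 0|
      ≤ max |min (x - 1) (θ - x) - min (y - 1) (θ - y)| |(0 : ℝ) - 0| :=
        abs_max_sub_max_le_max _ _ _ _
    _ ≤ max (max |x - 1 - (y - 1)| |θ - x - (θ - y)|) |(0 : ℝ) - 0| :=
        max_le_max (abs_min_sub_min_le_max _ _ _ _) le_rfl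
    _ = |x - y| := by
        rw [sub_zero, abs_zero, show x - 1 - (y - 1) = x - y by ring,
          show θ - x - (θ - y) = -(x - y) by ring, abs_neg, max_self, max_eq_left (abs_nonneg _)]

/-- The tent is a member at every `1 < θ < 2`. [cite: Zhang2022LandauSiegel, §7 (7.2) p.44] -/
theorem inClass_nuLipTent {θ : ℝ} (hθ1 : 1 < θ) (hθ2 : θ < 2) : (nuLipTent θ).InClass :=
  ⟨hθ1, hθ2, lipschitzWith_lipTent θ, (lipOverhang_lipTent θ).2⟩

/-- The two members of record and the tent, as a conjunction (C4). [cite: Zhang2022LandauSiegel, §7 (7.2) p.44] -/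
theorem nuLip_examples :
    familyNuLipOverhangAll.InClass (nuLipBump (21 / 20)) ∧ familyNuLipOverhangAll.InClass (nuLipBump (5 / 4)) ∧
      familyNuLipOverhangAll.InClass (nuLipTent (5 / 4)) :=
  ⟨inClass_nuLipBump_2120, inClass_nuLipBump_54, inClass_nuLipTent (by norm_num) (by norm_num)⟩

/-! ### Part 4b — C4 continued: the `len-nu-front-*` and `len-nu-back-*` rows (cubic profiles `(27/4)t(1−t)²`,
`(27/4)t²(1−t)`), sharp Lipschitz constant `27/(4(θ−1))` by the mean value inequality, and ALL 36 Lipschitz ν rows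
of BATCH-1 (3 shapes × 6 tops × 2 bulks) as members BY TERM -/

/-- Mean-value transfer on `[1, θ]` for a real polynomial: a bound `C` on `|p′|` there is a Lipschitz bound.
[cite: Zhang2022LandauSiegel, §7 (7.2) p.44] -/
theorem abs_eval_sub_le_of_derivative {p : Polynomial ℝ} {θ C : ℝ}
    (hC : ∀ z ∈ Icc 1 θ, |(Polynomial.derivative p).eval z| ≤ C) :
    ∀ x ∈ Icc 1 θ, ∀ y ∈ Icc 1 θ, |p.eval x - p.eval y| ≤ C * |x - y| := by
  intro x hx y hy
  have h := (convex_Icc 1 θ).norm_image_sub_le_of_norm_deriv_le (f := fun z => p.eval z) (C := C)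
    (fun z _ => p.differentiableAt) (fun z hz => by rw [Polynomial.deriv, Real.norm_eq_abs]; exact hC z hz) hy hx
  rwa [Real.norm_eq_abs, Real.norm_eq_abs] at h

/-- **The front-loaded bump of record** `(27/4)t(1−t)²`, `t = (z−1)/(θ−1)` (BATCH-1 shape «front»; at `θ = 5/4` the
coefficients `[−675, 1755, −1512, 432]`). [cite: Zhang2022LandauSiegel, §7 (7.2) p.44] -/
def frontPoly (θ : ℝ) : Polynomial ℝ :=
  Polynomial.C (27 / 4 / (θ - 1) ^ 3) * (Polynomial.X - Polynomial.C 1) * (Polynomial.C θ - Polynomial.X) ^ 2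

/-- **The back-loaded bump of record** `(27/4)t²(1−t)` (BATCH-1 shape «back»; at `θ = 5/4` the coefficients
`[540, −1512, 1404, −432]`). [cite: Zhang2022LandauSiegel, §7 (7.2) p.44] -/
def backPoly (θ : ℝ) : Polynomial ℝ :=
  Polynomial.C (27 / 4 / (θ - 1) ^ 3) * (Polynomial.X - Polynomial.C 1) ^ 2 * (Polynomial.C θ - Polynomial.X)

/-- values of the front bump. [cite: Zhang2022LandauSiegel, §7 (7.2) p.44] -/
theorem frontPoly_eval (θ z : ℝ) : (frontPoly θ).eval z = 27 / 4 / (θ - 1) ^ 3 * (z - 1) * (θ - z) ^ 2 := by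
  simp [frontPoly]

/-- values of the back bump. [cite: Zhang2022LandauSiegel, §7 (7.2) p.44] -/
theorem backPoly_eval (θ z : ℝ) : (backPoly θ).eval z = 27 / 4 / (θ - 1) ^ 3 * (z - 1) ^ 2 * (θ - z) := by
  simp [backPoly]

/-- at `θ = 5/4`: `−675 + 1755z − 1512z² + 432z³` (the design file's list). [cite: Zhang2022LandauSiegel, §7 (7.2) p.44] -/
theorem frontPoly_eval_five_fourths (z : ℝ) :
    (frontPoly (5 / 4)).eval z = -675 + 1755 * z - 1512 * z ^ 2 + 432 * z ^ 3 := by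
  rw [frontPoly_eval]; ring

/-- at `θ = 5/4`: `540 − 1512z + 1404z² − 432z³` (the design file's list). [cite: Zhang2022LandauSiegel, §7 (7.2) p.44] -/
theorem backPoly_eval_five_fourths (z : ℝ) :
    (backPoly (5 / 4)).eval z = 540 - 1512 * z + 1404 * z ^ 2 - 432 * z ^ 3 := by
  rw [backPoly_eval]; ring

/-- derivative of the front bump: `c·(θ − z)(θ + 2 − 3z)`. [cite: Zhang2022LandauSiegel, §7 (7.2) p.44] -/
theorem frontPoly_derivative_eval (θ z : ℝ) :
    (Polynomial.derivative (frontPoly θ)).eval z = 27 / 4 / (θ - 1) ^ 3 * ((θ - z) * (θ + 2 - 3 * z)) := by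
  simp [frontPoly, Polynomial.derivative_mul, pow_two]
  ring

/-- derivative of the back bump: `c·(z − 1)(2θ + 1 − 3z)`. [cite: Zhang2022LandauSiegel, §7 (7.2) p.44] -/
theorem backPoly_derivative_eval (θ z : ℝ) :
    (Polynomial.derivative (backPoly θ)).eval z = 27 / 4 / (θ - 1) ^ 3 * ((z - 1) * (2 * θ + 1 - 3 * z)) := by
  simp [backPoly, Polynomial.derivative_mul, pow_two]
  ring

/-- **The front bump is `27/(4(θ−1))`-Lipschitz on `[1,θ]`** (sharp: `|(θ−z)(θ+2−3z)| ≤ (θ−1)²` there).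
[cite: Zhang2022LandauSiegel, §7 (7.2) p.44] -/
theorem abs_frontPoly_sub_le {θ : ℝ} (hθ : 1 < θ) :
    ∀ x ∈ Icc 1 θ, ∀ y ∈ Icc 1 θ, |(frontPoly θ).eval x - (frontPoly θ).eval y| ≤ 27 / (4 * (θ - 1)) * |x - y| := by
  have hθ0 : 0 < θ - 1 := sub_pos.2 hθ
  refine abs_eval_sub_le_of_derivative fun z hz => ?_
  rw [frontPoly_derivative_eval, abs_mul, abs_of_pos (by positivity : (0:ℝ) < 27 / 4 / (θ - 1) ^ 3)]
  have hq : |(θ - z) * (θ + 2 - 3 * z)| ≤ (θ - 1) ^ 2 := by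
    have h1 : 0 ≤ z - 1 := by linarith [hz.1]
    have h2 : 0 ≤ θ - z := by linarith [hz.2]
    refine abs_le.2 ⟨?_, ?_⟩ <;> nlinarith [mul_nonneg h1 h2, sq_nonneg (θ - z), sq_nonneg (z - 1)]
  calc 27 / 4 / (θ - 1) ^ 3 * |(θ - z) * (θ + 2 - 3 * z)| ≤ 27 / 4 / (θ - 1) ^ 3 * (θ - 1) ^ 2 :=
        mul_le_mul_of_nonneg_left hq (by positivity)
    _ = 27 / (4 * (θ - 1)) := by field_simp

/-- **The back bump is `27/(4(θ−1))`-Lipschitz on `[1,θ]`** (sharp: `|(z−1)(2θ+1−3z)| ≤ (θ−1)²` there).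
[cite: Zhang2022LandauSiegel, §7 (7.2) p.44] -/
theorem abs_backPoly_sub_le {θ : ℝ} (hθ : 1 < θ) :
    ∀ x ∈ Icc 1 θ, ∀ y ∈ Icc 1 θ, |(backPoly θ).eval x - (backPoly θ).eval y| ≤ 27 / (4 * (θ - 1)) * |x - y| := by
  have hθ0 : 0 < θ - 1 := sub_pos.2 hθ
  refine abs_eval_sub_le_of_derivative fun z hz => ?_
  rw [backPoly_derivative_eval, abs_mul, abs_of_pos (by positivity : (0:ℝ) < 27 / 4 / (θ - 1) ^ 3)]
  have hq : |(z - 1) * (2 * θ + 1 - 3 * z)| ≤ (θ - 1) ^ 2 := by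
    have h1 : 0 ≤ z - 1 := by linarith [hz.1]
    have h2 : 0 ≤ θ - z := by linarith [hz.2]
    refine abs_le.2 ⟨?_, ?_⟩ <;> nlinarith [mul_nonneg h1 h2, sq_nonneg (θ - z), sq_nonneg (z - 1)]
  calc 27 / 4 / (θ - 1) ^ 3 * |(z - 1) * (2 * θ + 1 - 3 * z)| ≤ 27 / 4 / (θ - 1) ^ 3 * (θ - 1) ^ 2 :=
        mul_le_mul_of_nonneg_left hq (by positivity)
    _ = 27 / (4 * (θ - 1)) := by field_simp

/-- **Member of record `len-nu-front-u{52,32}-th{θ}`** (its ν-overhang): profile `polyProf θ (frontPoly θ)`,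
Lipschitz constant `27/(4(θ−1))`. [cite: Zhang2022LandauSiegel, §7 (7.2) p.44] -/
def nuLipFront (θ : ℝ) : NuLipDesign := ⟨θ, Real.toNNReal (27 / (4 * (θ - 1))), polyProf θ (frontPoly θ)⟩

/-- **Member of record `len-nu-back-u{52,32}-th{θ}`** (its ν-overhang): profile `polyProf θ (backPoly θ)`,
Lipschitz constant `27/(4(θ−1))`. [cite: Zhang2022LandauSiegel, §7 (7.2) p.44] -/
def nuLipBack (θ : ℝ) : NuLipDesign := ⟨θ, Real.toNNReal (27 / (4 * (θ - 1))), polyProf θ (backPoly θ)⟩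

/-- The front rows are members at every `1 < θ < 2`. [cite: Zhang2022LandauSiegel, §7 (7.2) p.44] -/
theorem inClass_nuLipFront {θ : ℝ} (hθ1 : 1 < θ) (hθ2 : θ < 2) : (nuLipFront θ).InClass := by
  refine ⟨hθ1, hθ2, lipschitzWith_polyProf hθ1.le (by rw [frontPoly_eval]; ring) (by rw [frontPoly_eval]; ring)
    fun x hx y hy => ?_, fun z hz => polyProf_support θ _ z hz⟩
  rw [nuLipFront, Real.coe_toNNReal _ (by have := sub_pos.2 hθ1; positivity)]
  exact abs_frontPoly_sub_le hθ1 x hx y hy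

/-- The back rows are members at every `1 < θ < 2`. [cite: Zhang2022LandauSiegel, §7 (7.2) p.44] -/
theorem inClass_nuLipBack {θ : ℝ} (hθ1 : 1 < θ) (hθ2 : θ < 2) : (nuLipBack θ).InClass := by
  refine ⟨hθ1, hθ2, lipschitzWith_polyProf hθ1.le (by rw [backPoly_eval]; ring) (by rw [backPoly_eval]; ring)
    fun x hx y hy => ?_, fun z hz => polyProf_support θ _ z hz⟩
  rw [nuLipBack, Real.coe_toNNReal _ (by have := sub_pos.2 hθ1; positivity)]
  exact abs_backPoly_sub_le hθ1 x hx y hy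

/-- **ALL 36 Lipschitz ν rows of BATCH-1 are members, BY TERM:** for each top of record
`θ ∈ {81/80, 41/40, 21/20, 17/16, 11/10, 5/4}` the bump, front and back overhangs are in the class (the two bulks
`ϰ(1, 5/2)`, `ϰ(1, 3/2)` of each row are the verdict's universally quantified `F`). [cite: Zhang2022LandauSiegel, §7 (7.2) p.44] -/
theorem nuLip_members_batch1 :
    ∀ θ ∈ ({81 / 80, 41 / 40, 21 / 20, 17 / 16, 11 / 10, 5 / 4} : Finset ℝ),
      (nuLipBump θ).InClass ∧ (nuLipFront θ).InClass ∧ (nuLipBack θ).InClass := by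
  intro θ hθ
  have h : 1 < θ ∧ θ < 2 := by
    simp only [Finset.mem_insert, Finset.mem_singleton] at hθ
    rcases hθ with rfl | rfl | rfl | rfl | rfl | rfl <;> constructor <;> norm_num
  exact ⟨inClass_nuLipBump h.1 h.2, inClass_nuLipFront h.1 h.2, inClass_nuLipBack h.1 h.2⟩

/-! ### Part 5 — the ABSOLUTE currency at the χψ scale `𝔞`, modulo NAMED SKELETON NODES ONLY: the weight-mass
binder of p468144 is discharged by the units lemma `Skeleton.discWeight_trivialScale_window` (KnifeEdgeDiscWeightScale:
`discWeight ≤ 3·𝓛⁹·𝔓` under Prop 7.1, Lemma 8.1, Prop 2.2 (i), Lemma 2.3) and `𝔞 ≥ a₀` (`frakALowerBound_holds`) -/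

/-- **The weight-mass binder at scale `𝔞`, from the manuscript's own nodes:** under `Prop71`, `Lemma81`, `Prop22i`,
`Lemma23` (CLAIMS, displayed) there is `W` with `discWeight ≤ W·𝓛⁹·(𝔞·𝔓)` for all large `D` under (A)
(`W = 3/a₀`, `a₀` the tree's lower bound of `𝔞`). [cite: Zhang2022LandauSiegel, §7 Prop 7.1, §8 Lemma 8.1, §2 (2.31), Lemma 5.7] -/
theorem discWeight_le_frakAScale (c' : ℝ) (h71 : Prop71 c') (h81 : Lemma81 c') (h22 : Prop22i)
    (h23 : Lemma23 c') :
    ∃ W : ℝ, ForAllLarge fun D _ χ => AssumptionA D χ →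
      KnifeEdge.discWeight c' χ ≤ W * ell D ^ 9 * (frakAScale D χ * frakP D) := by
  obtain ⟨a₀, ha₀, hA⟩ := frakALowerBound_holds
  refine ⟨3 / a₀, ((Skeleton.discWeight_trivialScale_window c' h71 h81 h22 h23).and hA).mono ?_⟩
  intro D _ χ _ _ h hAss
  obtain ⟨hw, ha⟩ := h
  have h3 := (hw hAss).2
  have haD : a₀ ≤ frakA χ := ha hAss
  have hD1 : (1 : ℝ) ≤ D := by exact_mod_cast NeZero.one_le
  have hℓ : 0 ≤ ell D := Real.log_nonneg hD1
  have hP : 0 ≤ frakP D := frakP_nonneg D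
  have h9P : 0 ≤ ell D ^ 9 * frakP D := mul_nonneg (pow_nonneg hℓ 9) hP
  rw [KnifeEdge.discWeight_eq_repair]
  calc Repair.discWeight c' χ ≤ 3 * ell D ^ 9 * frakP D := h3
    _ = 3 / a₀ * (ell D ^ 9 * frakP D) * a₀ := by field_simp
    _ ≤ 3 / a₀ * (ell D ^ 9 * frakP D) * frakA χ :=
        mul_le_mul_of_nonneg_left haD (by positivity)
    _ = 3 / a₀ * ell D ^ 9 * (frakAScale D χ * frakP D) := by simp only [frakAScale]; ring

/-- **MEAN-INVISIBILITY OF THE LIPSCHITZ ν-CLASS AT THE χψ SCALE `𝔞`, modulo named nodes only:**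
`Prop71 → Lemma81 → Prop22i → Lemma23 c′ → NuMeanInvisible c′ θ (lipOverhang θ) 𝔞` for `1 < θ ≤ 2` — the hypothesis
of p461177's shut-door theorems, now an implication from the SAME skeleton nodes the in-class (`R`) verdicts use; no
desk derivation, no E-074′ slot, no weight-mass binder left. [cite: Zhang2022LandauSiegel, §2 (2.16), (2.31), §3 (3.5), §4 (4.8), §7 Prop 7.1, §8 Lemma 8.1] -/
theorem nuMeanInvisible_lipOverhang_frakA {c' θ : ℝ} (hθ1 : 1 < θ) (hθ2 : θ ≤ 2) (h71 : Prop71 c')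
    (h81 : Lemma81 c') (h22 : Prop22i) (h23 : Lemma23 c') :
    NuMeanInvisible c' θ (lipOverhang θ) frakAScale := by
  obtain ⟨W, hW⟩ := discWeight_le_frakAScale c' h71 h81 h22 h23
  exact nuMeanInvisible_lipOverhang_of_weightMass hθ1 hθ2 frakAScale_eventuallyPos h22 (k := 9)
    (by norm_num) hW

/-- **THE DOOR IS SHUT for the Lipschitz ν-class, modulo named nodes only:** the (A)-world dictionary of the
class at scale `𝔞` is `(M, X) = (0, 0)` AND the class does not close (`KnifeEdge.not_nuCloses_of_invisible`,
p461177). [cite: Zhang2022LandauSiegel, §2 (2.16), Lemma 2.3, Prop. 2.2 (i), §7 Prop 7.1, §8 Lemma 8.1] -/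
theorem not_nuCloses_lipOverhang_frakA {c' θ : ℝ} (hθ1 : 1 < θ) (hθ2 : θ ≤ 2) (h71 : Prop71 c')
    (h81 : Lemma81 c') (h22 : Prop22i) (h23 : Lemma23 c') :
    NuDict c' θ (lipOverhang θ) frakAScale (fun _ _ => 0) 0 ∧ ¬ NuCloses (lipOverhang θ) (fun _ _ => 0) 0 :=
  not_nuCloses_of_invisible (nuMeanInvisible_lipOverhang_frakA hθ1 hθ2 h71 h81 h22 h23) h22 h23

/-- **No lever of either sign at scale `𝔞`, modulo named nodes only** (`KnifeEdge.mainTerm_add_nuPiece`, p461177):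
any family of test values with main constant `m ≥ 0` (shape of `Eval823`: `Ξ = m·𝔞𝔓 + o(𝔞𝔓)` under (A)) keeps the
main constant `m` after a Lipschitz νψ-overhang of top `θ ∈ (1, 2]` is added — ls-theory's ruling
«TRUE(u ⊕ v_ν) = TRUE(u)» as a kernel implication from `Prop71`, `Lemma81`, `Prop22i`, `Lemma23` for this class.
[cite: Zhang2022LandauSiegel, §2 (2.16), (2.31), §4 (4.8), §7 Prop 7.1, §8 Lemma 8.1, (8.23)] -/
theorem mainTerm_add_nuPiece_lipOverhang_frakA {c' θ : ℝ} (hθ1 : 1 < θ) (hθ2 : θ ≤ 2) (h71 : Prop71 c')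
    (h81 : Lemma81 c') (h22 : Prop22i) (h23 : Lemma23 c') {m : ℝ} (hm : 0 ≤ m)
    {F : (D : ℕ) → [NeZero D] → DirichletCharacter ℂ D → Skeleton.Chr D → ℂ → ℂ}
    (hF : ∀ ε : ℝ, 0 < ε → ForAllLarge fun D _ χ => AssumptionA D χ →
      |KnifeEdge.discMean c' χ (F D χ) - m * frakAScale D χ * frakP D| ≤ ε * frakAScale D χ * frakP D)
    {v v' : ℝ → ℂ} (hv : lipOverhang θ v v') :
    ∀ ε : ℝ, 0 < ε → ForAllLarge fun D _ χ => AssumptionA D χ →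
      |KnifeEdge.discMean c' χ (fun x s => F D χ x s + nuPoly χ x v ⌈bigP D ^ θ⌉₊ s)
          - m * frakAScale D χ * frakP D| ≤ ε * frakAScale D χ * frakP D :=
  mainTerm_add_nuPiece (nuMeanInvisible_lipOverhang_frakA hθ1 hθ2 h71 h81 h22 h23) frakAScale_eventuallyPos
    hm hF hv h22 h23

/-- **For the family's members, in the absolute currency:** every `d ∈ familyNuLipOverhangAll` glued to a bulk with
main constant `m ≥ 0` at scale `𝔞` keeps `m` (modulo the four named nodes). [cite: Zhang2022LandauSiegel, §2 (2.16), §7 Prop 7.1, §8 Lemma 8.1] -/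
theorem familyNuLipOverhangAll_mainTerm_add {d : NuLipDesign} (h : d.InClass) {c' : ℝ} (h71 : Prop71 c')
    (h81 : Lemma81 c') (h22 : Prop22i) (h23 : Lemma23 c') {m : ℝ} (hm : 0 ≤ m)
    {F : (D : ℕ) → [NeZero D] → DirichletCharacter ℂ D → Skeleton.Chr D → ℂ → ℂ}
    (hF : ∀ ε : ℝ, 0 < ε → ForAllLarge fun D _ χ => AssumptionA D χ →
      |KnifeEdge.discMean c' χ (F D χ) - m * frakAScale D χ * frakP D| ≤ ε * frakAScale D χ * frakP D) :
    ∀ ε : ℝ, 0 < ε → ForAllLarge fun D _ χ => AssumptionA D χ →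
      |KnifeEdge.discMean c' χ (fun x s => F D χ x s + nuPoly χ x d.v ⌈bigP D ^ d.θ⌉₊ s)
          - m * frakAScale D χ * frakP D| ≤ ε * frakAScale D χ * frakP D :=
  mainTerm_add_nuPiece_lipOverhang_frakA h.1 h.2.1.le h71 h81 h22 h23 hm hF h.lipOverhang

/-- **THE CONDITIONAL ROW'S SLOT IS DISCHARGED ON THE LIPSCHITZ IMAGE at scale `𝔞`, modulo named nodes** (in the
vocabulary of `RepairBlenMuNu`, p469249): for the image `d.toNuDesign` of a member, the CONCLUSION of
`familyNuOverhang c′ 𝔞`'s verdict — (i) dictionary of record `(M, X) = (0, 0)` on the Lipschitz class, (ii) lever-free: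
`HasMainConstant c′ 𝔞 F m → HasMainConstant c′ 𝔞 (d.toNuDesign.extend F) m` for every `m ≥ 0` and every bulk `F`
— holds from `Prop71`, `Lemma81`, `Prop22i`, `Lemma23 c′` WITHOUT the E-074′ slot `NuMeanInvisible c′ θ (bvOverhang θ) S`.
[cite: Zhang2022LandauSiegel, §2 (2.16), (2.31), §4 (4.8), §7 Prop 7.1, §8 Lemma 8.1] -/
theorem familyNuOverhang_conclusion_of_nuLip {d : NuLipDesign} (h : d.InClass) {c' : ℝ} (h71 : Prop71 c')
    (h81 : Lemma81 c') (h22 : Prop22i) (h23 : Lemma23 c') :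
    NuDict c' d.θ (lipOverhang d.θ) frakAScale (fun _ _ => 0) 0 ∧
      ∀ m : ℝ, 0 ≤ m → ∀ F : (D : ℕ) → [NeZero D] → DirichletCharacter ℂ D → Skeleton.Chr D → ℂ → ℂ,
        HasMainConstant c' frakAScale F m → HasMainConstant c' frakAScale (d.toNuDesign.extend F) m :=
  ⟨(not_nuCloses_lipOverhang_frakA h.1 h.2.1.le h71 h81 h22 h23).1,
    fun _ hm _ hF => familyNuLipOverhangAll_mainTerm_add h h71 h81 h22 h23 hm hF⟩

/-! ### Part 6 — the word's ν VARIANTS that are PROFILE CHANGES inside the class: «ν·log n» in Zhang's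
normalisation `ν(n)·(log n/log P)` and the twist `(P_j/n)^β` at the method's scale `β = b/log P` (ls-Blen-plan g2
21:15:32Z (4)); «ν∗(smooth)» is NOT of the form `(1∗χ)(n)·w(z_n)` and stays uncovered (declared) -/

/-- **A bounded Lipschitz multiplier on `[1,θ]` keeps the class:** if `v` is `K`-Lipschitz and vanishes off `[1,θ]`
(`θ ≥ 1`) and `g` satisfies `‖g‖ ≤ G`, `‖g(x) − g(y)‖ ≤ L|x − y|` on `[1,θ]`, then `z ↦ g(clampI θ z)·v(z)` is
`(G·K + L·K(θ−1))`-Lipschitz on `ℝ`. [cite: Zhang2022LandauSiegel, §7 (7.2) p.44] -/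
theorem lipschitzWith_mul_of_overhang {θ : ℝ} (hθ : 1 ≤ θ) {v : ℝ → ℂ} {K : ℝ≥0} (hv : LipschitzWith K v)
    (hsupp : ∀ z, z < 1 ∨ θ < z → v z = 0) {g : ℝ → ℂ} {G L : ℝ≥0} (hG : ∀ z ∈ Icc 1 θ, ‖g z‖ ≤ G)
    (hL : ∀ x ∈ Icc 1 θ, ∀ y ∈ Icc 1 θ, ‖g x - g y‖ ≤ L * |x - y|) :
    LipschitzWith (G * K + L * (K * (θ - 1)).toNNReal) (fun z => g (clampI θ z) * v z) := by
  refine LipschitzWith.of_dist_le_mul fun x y => ?_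
  rw [dist_eq_norm, Real.dist_eq]
  have e : g (clampI θ x) * v x - g (clampI θ y) * v y
      = g (clampI θ x) * (v x - v y) + (g (clampI θ x) - g (clampI θ y)) * v y := by ring
  rw [e]
  have h1 : ‖g (clampI θ x) * (v x - v y)‖ ≤ G * (K * |x - y|) := by
    rw [norm_mul]
    exact mul_le_mul (hG _ (clampI_mem hθ x)) (LipOverhang.norm_sub_le hv y x) (norm_nonneg _) G.2
  have h2 : ‖(g (clampI θ x) - g (clampI θ y)) * v y‖ ≤ L * |x - y| * (K * (θ - 1)) := by
    rw [norm_mul]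
    exact mul_le_mul ((hL _ (clampI_mem hθ x) _ (clampI_mem hθ y)).trans
      (mul_le_mul_of_nonneg_left (abs_clampI_sub_le θ x y) L.2)) (LipOverhang.norm_le hv hsupp hθ y)
      (norm_nonneg _) (mul_nonneg L.2 (abs_nonneg _))
  have hKθ : (((K : ℝ) * (θ - 1)).toNNReal : ℝ) = K * (θ - 1) :=
    Real.coe_toNNReal _ (mul_nonneg K.2 (by linarith))
  calc ‖g (clampI θ x) * (v x - v y) + (g (clampI θ x) - g (clampI θ y)) * v y‖
      ≤ ‖g (clampI θ x) * (v x - v y)‖ + ‖(g (clampI θ x) - g (clampI θ y)) * v y‖ := norm_add_le _ _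
    _ ≤ G * (K * |x - y|) + L * |x - y| * (K * (θ - 1)) := add_le_add h1 h2
    _ = (G * K + L * (K * (θ - 1))) * |x - y| := by ring
    _ = ((G * K + L * (K * (θ - 1)).toNNReal : ℝ≥0) : ℝ) * |x - y| := by push_cast; rw [hKθ]

/-- … and still vanishes off `[1, θ]`. [cite: Zhang2022LandauSiegel, §7 (7.2) p.44] -/
theorem mul_support_of_overhang {θ : ℝ} {v : ℝ → ℂ} (hsupp : ∀ z, z < 1 ∨ θ < z → v z = 0) (g : ℝ → ℂ)
    (z : ℝ) (hz : z < 1 ∨ θ < z) : g (clampI θ z) * v z = 0 := by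
  rw [hsupp z hz, mul_zero]

/-- **The twisted member** `(θ, K, v) ↦ (θ, G·K + L·K(θ−1), g∘clamp · v)`. [cite: Zhang2022LandauSiegel, §7 (7.2) p.44] -/
def NuLipDesign.twist (d : NuLipDesign) (g : ℝ → ℂ) (G L : ℝ≥0) : NuLipDesign :=
  ⟨d.θ, G * d.K + L * (d.K * (d.θ - 1)).toNNReal, fun z => g (clampI d.θ z) * d.v z⟩

/-- Twisting by a bounded Lipschitz multiplier keeps membership. [cite: Zhang2022LandauSiegel, §7 (7.2) p.44] -/
theorem NuLipDesign.InClass.twist {d : NuLipDesign} (h : d.InClass) {g : ℝ → ℂ} {G L : ℝ≥0}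
    (hG : ∀ z ∈ Icc 1 d.θ, ‖g z‖ ≤ G) (hL : ∀ x ∈ Icc 1 d.θ, ∀ y ∈ Icc 1 d.θ, ‖g x - g y‖ ≤ L * |x - y|) :
    (d.twist g G L).InClass :=
  ⟨h.1, h.2.1, lipschitzWith_mul_of_overhang h.1.le h.2.2.1 h.2.2.2 hG hL,
    fun z hz => mul_support_of_overhang h.2.2.2 g z hz⟩

/-- **The variant «ν·log n» in Zhang's normalisation:** the νψ-polynomial with coefficients
`ν(n)ψ(n)·(log n/log P)·v(z_n)·n^{−s}`. [cite: Zhang2022LandauSiegel, §2 (2.16); §7 (7.2)] -/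
def nuLogPoly {D : ℕ} [NeZero D] (χ : DirichletCharacter ℂ D) (x : Skeleton.Chr D) (v : ℝ → ℂ) (N : ℕ)
    (s : ℂ) : ℂ :=
  ∑ n ∈ Finset.Ico 1 N, nu χ n * x.ψ (n : ZMod x.p) *
    (((Real.log n / Real.log (bigP D) : ℝ) : ℂ) * v (Real.log n / Real.log (bigP D))) * (n : ℂ) ^ (-s)

/-- **«ν·log n» IS a profile change:** `nuLogPoly v = nuPoly (z ↦ clamp(z)·v(z))` for a profile vanishing off
`[1,θ]` (on the support `clamp(z_n) = z_n`; off it both sides vanish). [cite: Zhang2022LandauSiegel, §2 (2.16); §7 (7.2)] -/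
theorem nuLogPoly_eq_nuPoly {θ : ℝ} {v : ℝ → ℂ} (hsupp : ∀ z, z < 1 ∨ θ < z → v z = 0) {D : ℕ} [NeZero D]
    (χ : DirichletCharacter ℂ D) (x : Skeleton.Chr D) (N : ℕ) (s : ℂ) :
    nuLogPoly χ x v N s = nuPoly χ x (fun z => ((clampI θ z : ℝ) : ℂ) * v z) N s := by
  unfold nuLogPoly nuPoly
  refine Finset.sum_congr rfl fun n _ => ?_
  congr 2
  beta_reduce
  set z : ℝ := Real.log n / Real.log (bigP D)
  by_cases hz : 1 ≤ z ∧ z ≤ θ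
  · rw [clampI_eq_self ⟨hz.1, hz.2⟩]
  · have : v z = 0 := hsupp z (by rcases not_and_or.mp hz with h | h <;> [left; right] <;> exact not_le.mp h)
    rw [this, mul_zero, mul_zero]

/-- **The «ν·log n» member:** `(θ, K, v) ↦ (θ, θ·K + K(θ−1), z ↦ clamp(z)·v(z))` (multiplier `g(z) = z`: `|g| ≤ θ`,
`1`-Lipschitz on `[1,θ]`). [cite: Zhang2022LandauSiegel, §7 (7.2) p.44] -/
def NuLipDesign.logTwist (d : NuLipDesign) : NuLipDesign := d.twist (fun z => ((z : ℝ) : ℂ)) d.θ.toNNReal 1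

/-- The «ν·log n» variant of a member is a member (so its verdict is `familyNuLipOverhangAll_decided _ h.logTwist`,
with `nuLogPoly_eq_nuPoly` identifying the glued piece). [cite: Zhang2022LandauSiegel, §7 (7.2) p.44] -/
theorem NuLipDesign.InClass.logTwist {d : NuLipDesign} (h : d.InClass) : d.logTwist.InClass := by
  refine h.twist (fun z hz => ?_) (fun x hx y hy => ?_)
  · rw [Complex.norm_real, Real.norm_eq_abs, abs_of_pos (by linarith [hz.1]),
      Real.coe_toNNReal _ (by linarith [hz.1, hz.2])]
    exact hz.2
  · rw [← Complex.ofReal_sub, Complex.norm_real, Real.norm_eq_abs, NNReal.coe_one, one_mul]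

/-- **The verdict for the «ν·log n» variant of any member, stated on `nuLogPoly`:** no main-order gain or loss
(relative currency, (b)-binders displayed), rate `δ′ = 4(θK + K(θ−1))·𝓛^{−180}`.
[cite: Zhang2022LandauSiegel, §2 (2.16); §3 (3.5); §4 (4.8)] -/
theorem not_mainOrderGain_nuLog {d : NuLipDesign} (h : d.InClass) (c' : ℝ) :
    ForAllLarge fun D _ χ =>
      (∀ i ∈ idx χ, (i.2).re = 1 / 2) →
        (∀ i ∈ idx χ, 0 ≤ (cstar c' D i.1 i.2).re * (omegaW D i.2).re) →
          ∀ F : Skeleton.Chr D → ℂ → ℂ,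
            ¬ (d.logTwist.rate D * (KnifeEdge.discMean c' χ F + KnifeEdge.discWeight c' χ)
                  + d.logTwist.rate D ^ 2 * KnifeEdge.discWeight c' χ <
                |KnifeEdge.discMean c' χ (fun x s => F x s + nuLogPoly χ x d.v ⌈bigP D ^ d.θ⌉₊ s)
                  - KnifeEdge.discMean c' χ F|) := by
  refine (familyNuLipOverhangAll_decided _ h.logTwist c').mono fun D _ χ _ _ hh hline hw F => ?_
  have e : (fun (x : Skeleton.Chr D) (s : ℂ) => F x s + nuLogPoly χ x d.v ⌈bigP D ^ d.θ⌉₊ s)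
      = fun x s => F x s + nuPoly χ x d.logTwist.v ⌈bigP D ^ d.logTwist.θ⌉₊ s := by
    funext x s
    rw [nuLogPoly_eq_nuPoly h.2.2.2]
    rfl
  rw [e]
  exact hh hline hw F

/-- **The twist `(P_j/n)^β` at the method's scale `β = b/log P`** is the multiplier `g(z) = e^{b(z_j − z)}` on the
logarithmic scale (`(P^{z_j}/n)^{b/log P} = e^{b(z_j − z_n)}`): bounded by `e^{|b|(|z_j| + θ)}` and
`|b|·e^{|b|(|z_j| + θ)}`-Lipschitz on `[1, θ]`, hence a profile change inside the class (`NuLipDesign.InClass.twist`).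
A twist at a FIXED exponent `β > 0` (gain `P^{(θ−1)β}`) is NOT covered. [cite: Zhang2022LandauSiegel, §7 (7.2) p.44] -/
theorem expTwist_bounds (b zj θ : ℝ) :
    (∀ z ∈ Icc 1 θ, ‖((Real.exp (b * (zj - z)) : ℝ) : ℂ)‖ ≤ (Real.exp (|b| * (|zj| + θ))).toNNReal) ∧
      ∀ x ∈ Icc 1 θ, ∀ y ∈ Icc 1 θ,
        ‖((Real.exp (b * (zj - x)) : ℝ) : ℂ) - ((Real.exp (b * (zj - y)) : ℝ) : ℂ)‖ ≤
          ((|b| * Real.exp (|b| * (|zj| + θ))).toNNReal : ℝ≥0) * |x - y| := by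
  have hbound : ∀ z ∈ Icc 1 θ, Real.exp (b * (zj - z)) ≤ Real.exp (|b| * (|zj| + θ)) := by
    intro z hz
    refine Real.exp_le_exp.2 ?_
    calc b * (zj - z) ≤ |b * (zj - z)| := le_abs_self _
      _ = |b| * |zj - z| := abs_mul _ _
      _ ≤ |b| * (|zj| + θ) := mul_le_mul_of_nonneg_left
          ((abs_sub _ _).trans (add_le_add le_rfl (by rw [abs_of_pos (by linarith [hz.1])]; exact hz.2)))
          (abs_nonneg _)
  have hE : 0 ≤ Real.exp (|b| * (|zj| + θ)) := (Real.exp_pos _).le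
  refine ⟨fun z hz => ?_, fun x hx y hy => ?_⟩
  · rw [Complex.norm_real, Real.norm_eq_abs, abs_of_pos (Real.exp_pos _), Real.coe_toNNReal _ hE]
    exact hbound z hz
  · rw [← Complex.ofReal_sub, Complex.norm_real, Real.coe_toNNReal _ (mul_nonneg (abs_nonneg _) hE)]
    -- mean value inequality on the convex set `[1, θ]` for `f(z) = exp (b (zj − z))`, `f′ = −b f`
    have hf : ∀ z ∈ Icc 1 θ, DifferentiableAt ℝ (fun z => Real.exp (b * (zj - z))) z := fun z _ => by fun_prop
    have hderiv : ∀ z, deriv (fun z => Real.exp (b * (zj - z))) z = -b * Real.exp (b * (zj - z)) := by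
      intro z
      have h1 : HasDerivAt (fun z => b * (zj - z)) (-b) z := by
        simpa using ((hasDerivAt_id z).const_sub zj).const_mul b
      simpa [mul_comm] using (h1.exp).deriv
    have hbd : ∀ z ∈ Icc 1 θ, ‖deriv (fun z => Real.exp (b * (zj - z))) z‖ ≤ |b| * Real.exp (|b| * (|zj| + θ)) := by
      intro z hz
      rw [hderiv, Real.norm_eq_abs, abs_mul, abs_neg, abs_of_pos (Real.exp_pos _)]
      exact mul_le_mul_of_nonneg_left (hbound z hz) (abs_nonneg _)
    have := (convex_Icc 1 θ).norm_image_sub_le_of_norm_deriv_le hf hbd hy hx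
    rw [Real.norm_eq_abs, Real.norm_eq_abs] at this
    exact this

/-- **The `(P_j/n)^{b/log P}`-twisted member** (`z_j` = the logarithmic position of `P_j`).
[cite: Zhang2022LandauSiegel, §7 (7.2) p.44] -/
def NuLipDesign.expTwist (d : NuLipDesign) (b zj : ℝ) : NuLipDesign :=
  d.twist (fun z => ((Real.exp (b * (zj - z)) : ℝ) : ℂ)) (Real.exp (|b| * (|zj| + d.θ))).toNNReal
    (|b| * Real.exp (|b| * (|zj| + d.θ))).toNNReal

/-- The twisted variant of a member is a member (verdict: `familyNuLipOverhangAll_decided _ (h.expTwist b zj)`).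
[cite: Zhang2022LandauSiegel, §7 (7.2) p.44] -/
theorem NuLipDesign.InClass.expTwist {d : NuLipDesign} (h : d.InClass) (b zj : ℝ) :
    (d.expTwist b zj).InClass :=
  h.twist (expTwist_bounds b zj d.θ).1 (expTwist_bounds b zj d.θ).2

end Repair

end Literature.NumberTheory.LFunctions.Zhang2022

end
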